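import Summits.ABC.StewartYu.ArchG3RecLinesKPieces
import Summits.ABC.StewartYu.ArchG3RecLinesE
import HarnessLib

/-!
# The archimedean record `ArchG3Rec` — the k-step families K0/K of the closed letter lines `LinesClosedK κ c`, file 3/3:
# the U₀-DOMINATED conjuncts (smallness, the jets line (J), the closing line (C))
# (cell abc-stewartyu, crux r2 `ArchCoreRat` stmt-ABC-20502, line `arch-g3-frame`, seam (B) of `stub_recLinesArch`; plan R50/R50′, seat p4 g10)

Support file (theorems only; no named facts, no definitions).  For a record `P : ArchG3Rec n` with SORTED weights
(`Monotone P.A`, R50′), `n ≥ 2`, an adjugate parameter `1 ≤ κ ≤ 2ⁿ` (the line closes at `κ = 2^{n−1}`) and a level/step `(lev, ν)` with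
`lev ≤ Ŝ`, `ν < n` (this covers BOTH k-step families of `LinesClosedK`: `(0, ν)` and `(lev+1, ν)`), the three conjuncts of
`P.KStepLinesK κ c lev ν` that carry the negated crux bound `−U₀(c) = −cⁿ·Ω·W` (inside `cbRK`, `δR c = e^{−U₀}`):

* `kj_small` — the smallness side condition `LbRK κ lev jl·δR c·(3·Nf lev ν + 2) ≤ 1` (from `Z ≤ U₀(c)`);
* `kStepJ_holds` — the jets line (J); `kStepC_holds` — the closing line (C); both from `(hU0 : 2^{8n}·Z ≤ U₀(c))` (✓ `U0_ge 8`: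
  `2^68 ≤ c`) and the two GLOBAL atoms of p1's letter sheet that are not closed forms of this chain — `(hcP : cPRK κ ≤ cPz·Z)`,
  `(hWC : log WC(H, Ŝ−lev, L₀, Tf lev ν, 3Nf lev ν+2) ≤ cWz·Z)`, `cPz, cWz ≤ 4` (p1's `cPRK_le` / `logWC_le` discharge them);
* `kj_logWC` — discharges `hWC` with `cWz = 2` from p1's ✓ `logWC_le`/`L₀_mul_le` (`ArchG3RecLinesE`);
* `kStepLinesK_of_far` — `P.KStepLinesK κ c lev ν` from the above, p1's ✓ `side_kstep`, `(hcP : cPRK κ ≤ cPz·Z)` (`cPz ≤ 4`; p1's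
  `cPRK_two_pow_le` gives 51/25 at `κ = 2^{n−1}`) and the far line (F) as a hypothesis (p1's parcel `kstepF_holds`);
* `kFamilies_of_far` — BOTH K clauses of `LinesClosedK (2^{n−1}) c` (level 0 and `lev+1 ≤ Ŝ`) at the floor `2^68 ≤ c` — the K0/K input of
  p5's assembly `linesClosedK_holds`.

Ledger (unit `M = 2ⁿ·Z`, pieces in `ArchG3RecLinesKPieces`): `γb·Nf ≤ (n+2)/16·M`, Schwarz-log `≤ 6M`, `T·log(2·CRK) ≤ Z`, `a·log 2 + T ≤ Z/2`,
`cUR ≤ Z/8`, `log DΔC ≤ Z`, `(γb+wl)·Nf ≤ (n+4)/16·M`, `cbRK ≤ Z/8 − U₀` (`kj_cbRK`), `cDR ≤ (n+1)·M` (`kj_cDR`), `2ⁿ(2n+16) + 16 ≤ 2^{8n}`.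

WHAT THIS IS NOT: not the far line (F) of the k-steps (p1), not the O/H families (p2/p5), not the assembly `linesClosedK_holds` (p5).

## References
* [Nesterenko2003] Yu. V. Nesterenko, LNM 1819 (2003) — §4.2 (4.24)–(4.35), p. 87–90; §3.5 (3.23)–(3.25), (3.36)–(3.37).
* [Matveev2000] E. M. Matveev, Izv. Math. 64 (2000), §3 (shape of the slab weights `γb`, `wl`).
-/

noncomputable section

open Finset Real
open scoped Nat
open Summit.ABC.StewartYu.ArchSupply (WC)
open Summit.ABC.StewartYu.ArchG3Setup (DΔC)

namespace Summit.ABC.StewartYu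

namespace ArchG3Rec

open PadicG3Par (Cb Cb_pos)
open ArchG3Par (G K yloadK G_eq G_pos K_pos yloadK_pos eight_le_G)

variable {n : ℕ} (P : ArchG3Rec n)

/-- **the box ceiling against `Z`**: `cbRK κ c lev m ≤ Z/8 − U₀(c)` for `m ≤ 2^{n+lev}·X`, `lev ≤ Ŝ`, `1 ≤ κ ≤ 2ⁿ`. [folklore] -/
theorem kj_cbRK (κ : ℕ) (hκ : 1 ≤ κ) (hκ2 : (κ : ℝ) ≤ 2 ^ n) (c : ℝ) {lev : ℕ} (hlev : lev ≤ P.Sd) {m : ℕ}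
    (hm : (m : ℝ) ≤ 2 ^ (n + lev) * P.X) : P.cbRK κ c lev m ≤ P.Z / 8 - P.U0 c := by
  unfold cbRK
  obtain ⟨-, -, hLb, hLb0⟩ := P.LbRK_le κ hκ lev P.jl
  obtain ⟨hlogN, hlogL, hlogX, hlogκ, hlogn, hlogL0, hlogX0, hlogN0, hlogκ0⟩ := P.kj_logs κ hκ hκ2
  obtain ⟨hZ0, -⟩ := P.kj_units
  obtain ⟨h16, -, -, -, hL512, -, hX, hWN, -⟩ := P.kj_units2
  obtain ⟨-, hlevL⟩ := P.kj_Sd hlev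
  have hN1 := P.N_facts.2.1
  have hL1 := P.L_real.1
  have hX1 : (1 : ℝ) ≤ P.X := by have := P.X_floors.2.1; linarith
  have hn1 : (1 : ℝ) ≤ n := by exact_mod_cast P.hn
  have hκ1 : (1 : ℝ) ≤ κ := by exact_mod_cast hκ
  have hl2 : Real.log 2 ≤ 1 := by have := Real.log_two_lt_d9; linarith
  -- `log(LbRK + 1) ≤ log(5 κ n N L) ≤ 2 + n + n + WN + L/2^21`
  have h1 : Real.log ((P.LbRK κ lev P.jl : ℝ) + 1) ≤ 2 + n + n + P.WN + P.L / 2 ^ 21 := by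
    have hprod : (1 : ℝ) ≤ (κ : ℝ) * n * P.N * P.L :=
      one_le_mul_of_one_le_of_one_le (one_le_mul_of_one_le_of_one_le (one_le_mul_of_one_le_of_one_le hκ1 hn1) hN1) hL1
    have hle : (P.LbRK κ lev P.jl : ℝ) + 1 ≤ 5 * ((κ : ℝ) * n * P.N * P.L) := by nlinarith
    have h5 : Real.log 5 ≤ 2 := by
      have h : (5 : ℝ) ≤ Real.exp 2 := by
        have h2 : Real.exp 2 = Real.exp 1 ^ 2 := by rw [← Real.exp_nat_mul]; norm_num
        rw [h2]; have := Real.exp_one_gt_d9; nlinarith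
      calc Real.log 5 ≤ Real.log (Real.exp 2) := Real.log_le_log (by norm_num) h
        _ = 2 := Real.log_exp 2
    calc Real.log ((P.LbRK κ lev P.jl : ℝ) + 1) ≤ Real.log (5 * ((κ : ℝ) * n * P.N * P.L)) :=
          Real.log_le_log (by positivity) hle
      _ = Real.log 5 + (Real.log κ + Real.log n + Real.log P.N + Real.log P.L) := by
          rw [Real.log_mul (by norm_num) (by positivity), Real.log_mul (by positivity) (by positivity),
            Real.log_mul (by positivity) (by positivity), Real.log_mul (by positivity) (by positivity)]
      _ ≤ 2 + n + n + P.WN + P.L / 2 ^ 21 := by linarith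
  -- `log(m+1) ≤ log(2^{n+lev+1} X) ≤ n + lev + 1 + X`
  have h2 : Real.log ((m : ℝ) + 1) ≤ (n : ℝ) + lev + 1 + P.X := by
    have h2p : (1 : ℝ) ≤ 2 ^ (n + lev) := one_le_pow₀ (by norm_num)
    have hle : (m : ℝ) + 1 ≤ 2 ^ (n + lev + 1) * P.X := by rw [pow_succ]; nlinarith
    have hm0 : (0 : ℝ) ≤ m := Nat.cast_nonneg m
    calc Real.log ((m : ℝ) + 1) ≤ Real.log (2 ^ (n + lev + 1) * P.X) := Real.log_le_log (by positivity) hle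
      _ = ((n + lev + 1 : ℕ) : ℝ) * Real.log 2 + Real.log P.X := by rw [Real.log_mul (by positivity) (by positivity), Real.log_pow]
      _ ≤ (n : ℝ) + lev + 1 + P.X := by
          push_cast
          have h0 : (0 : ℝ) ≤ (n : ℝ) + lev + 1 := by positivity
          nlinarith
  have hL0 : (0 : ℝ) ≤ P.L := Nat.cast_nonneg _
  have hn0 : (0 : ℝ) ≤ n := Nat.cast_nonneg n
  linarith [h1, h2, hl2, h16, hL512, hX, hWN, hlevL, hZ0]

/-- **the direction cost against `Z`**: `cDR lev a |x₁| ≤ (n+1)·2ⁿ·Z` for `a < Tf lev (ν+1)`, `|x₁| ≤ Nf lev (ν+1)`, `ν < n`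
(`a·H ≤ (33/2)(n+1)·L·H ≤ (33/128)Z`, `2|x₁|·Σⱼ(LνRR/N)A ≤ 3n·2^{ν+1}·X·L`, `2·SAR ≤ 2nΩ`). [folklore] -/
theorem kj_cDR (hn2 : 2 ≤ n) {lev ν : ℕ} (hν : ν < n) {a : ℕ} (ha : a < P.Tf lev (ν + 1)) {x₁ : ℤ}
    (hx : |x₁| ≤ (P.Nf lev (ν + 1) : ℤ)) : P.cDR lev a |(x₁ : ℝ)| ≤ ((n : ℝ) + 1) * (2 ^ n * P.Z) := by
  unfold cDR
  have haT : (a : ℝ) ≤ P.Tf 0 0 := by exact_mod_cast (ha.le.trans (P.Tf_le_Tf00 lev (ν + 1)))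
  have hT00 := P.Tf00_le hn2
  have hLH := P.L_H_le
  obtain ⟨hH1, -, -⟩ := P.H_bounds
  obtain ⟨-, hS, hS0⟩ := P.LνRR_A_le lev
  obtain ⟨hSAR, -, hSAR0⟩ := P.SAR_le
  obtain ⟨hZ0, -, -, hXL, -⟩ := P.kj_units
  obtain ⟨-, hnZ, h2Z, -, -, -, -, -, hΩ⟩ := P.kj_units2
  obtain ⟨-, -, -, hNf, -⟩ := P.kj_nodes lev (ν + 1)
  have hxR : |(x₁ : ℝ)| ≤ P.Nf lev (ν + 1) := by
    have h := hx
    have : ((|x₁| : ℤ) : ℝ) ≤ ((P.Nf lev (ν + 1) : ℤ) : ℝ) := by exact_mod_cast h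
    simpa [Int.cast_abs] using this
  have hn0 : (0 : ℝ) ≤ n := Nat.cast_nonneg n
  have ha0 : (0 : ℝ) ≤ a := Nat.cast_nonneg a
  have hL0 : (0 : ℝ) ≤ P.L := Nat.cast_nonneg _
  have hX0 : (0 : ℝ) ≤ P.X := Nat.cast_nonneg _
  have hH0 : (0 : ℝ) ≤ P.H := by linarith
  -- (1) `a·H ≤ (33/2)(n+1) L·H ≤ (33/128) Z`
  have h1 : (a : ℝ) * P.H ≤ 33 / 128 * P.Z := by
    have h := mul_le_mul_of_nonneg_right (haT.trans hT00) hH0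
    have h' : ((n : ℝ) + 1) * ((P.L : ℝ) * P.H) ≤ P.Z / 64 := by
      rw [le_div_iff₀ (by norm_num)]; rw [le_div_iff₀ (by positivity)] at hLH; linarith
    linarith
  -- (2) `|x₁|·Σ ≤ 2^{ν+1+lev} X·(3/2) n L/2^lev = 3n·2^ν·X·L ≤ (3/2) n 2ⁿ XL`
  have h2ν : (2 : ℝ) ^ (ν + 1) ≤ 2 ^ n := pow_le_pow_right₀ (by norm_num) (by omega)
  have h2 : |(x₁ : ℝ)| * ∑ j, (P.LνRR lev j : ℝ) / P.N * P.A j ≤ 3 / 2 * n * (2 ^ n * ((P.X : ℝ) * P.L)) := by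
    calc |(x₁ : ℝ)| * ∑ j, (P.LνRR lev j : ℝ) / P.N * P.A j ≤ (2 ^ (ν + 1 + lev) * P.X) * (3 / 2 * n * P.L / 2 ^ lev) :=
          mul_le_mul (hxR.trans hNf) hS hS0 (by positivity)
      _ = 3 / 2 * n * (2 ^ (ν + 1) * ((P.X : ℝ) * P.L)) := by rw [pow_add]; field_simp
      _ ≤ 3 / 2 * n * (2 ^ n * ((P.X : ℝ) * P.L)) := by gcongr
  have h3 : 2 ^ n * ((P.X : ℝ) * P.L) ≤ 2 ^ n * (P.Z / 8) := mul_le_mul_of_nonneg_left hXL (by positivity)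
  have h4 : (n : ℝ) * (2 ^ n * ((P.X : ℝ) * P.L)) ≤ n * (2 ^ n * (P.Z / 8)) := mul_le_mul_of_nonneg_left h3 hn0
  have h5 : (n : ℝ) * P.Ω ≤ n * (P.Z / 2 ^ 29) := mul_le_mul_of_nonneg_left hΩ hn0
  have hM0 : 0 ≤ (n : ℝ) * (2 ^ n * P.Z) := by positivity
  linarith [h1, h2, h4, h5, hSAR, hnZ, h2Z, hZ0, hM0]

/-- **THE SMALLNESS SIDE CONDITION of the k-steps**: `LbRK κ lev jl·δR c·(3·Nf lev ν + 2) ≤ 1` for `Z ≤ U₀(c)`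
(`log(LbRK·(3Nf+2)) ≤ 4n + 7 + WN + L + X ≤ Z`). [cite: Nesterenko2003, §4.2 (4.24); shape only] -/
theorem kj_small (κ : ℕ) (hκ : 1 ≤ κ) (hκ2 : (κ : ℝ) ≤ 2 ^ n) {lev ν : ℕ} (hlev : lev ≤ P.Sd) (hν : ν ≤ n) {c : ℝ}
    (hU0 : P.Z ≤ P.U0 c) : (P.LbRK κ lev P.jl : ℝ) * P.δR c * (3 * P.Nf lev ν + 2) ≤ 1 := by
  unfold δR
  obtain ⟨-, -, hLb, hLb0⟩ := P.LbRK_le κ hκ lev P.jl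
  obtain ⟨hlogN, hlogL, hlogX, hlogκ, hlogn, hlogL0, hlogX0, hlogN0, hlogκ0⟩ := P.kj_logs κ hκ hκ2
  obtain ⟨hZ0, -⟩ := P.kj_units
  obtain ⟨h16, -, -, -, hL512, -, hX, hWN, -⟩ := P.kj_units2
  obtain ⟨-, hlevL⟩ := P.kj_Sd hlev
  obtain ⟨-, -, hNf1, hNf, -⟩ := P.kj_nodes lev ν
  have hN1 := P.N_facts.2.1
  have hL1 := P.L_real.1
  have hX1 : (1 : ℝ) ≤ P.X := by have := P.X_floors.2.1; linarith
  have hn1 : (1 : ℝ) ≤ n := by exact_mod_cast P.hn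
  have hκ1 : (1 : ℝ) ≤ κ := by exact_mod_cast hκ
  have hl2 : Real.log 2 ≤ 1 := by have := Real.log_two_lt_d9; linarith
  have hL0 : (0 : ℝ) ≤ P.L := Nat.cast_nonneg _
  set Q : ℝ := (P.LbRK κ lev P.jl : ℝ) * (3 * P.Nf lev ν + 2) with hQ
  have hQle : Q ≤ Real.exp (P.U0 c) := by
    rcases eq_or_lt_of_le hLb0 with h0 | hpos
    · have : Q = 0 := by rw [hQ, ← h0, zero_mul]
      rw [this]; exact (Real.exp_pos _).le
    have hQpos : 0 < Q := by rw [hQ]; positivity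
    rw [← Real.exp_log hQpos, Real.exp_le_exp]
    -- `log Q = log LbRK + log(3Nf+2)`
    have hA : Real.log (P.LbRK κ lev P.jl : ℝ) ≤ 2 + n + n + P.WN + P.L / 2 ^ 21 := by
      have hprod : (1 : ℝ) ≤ (κ : ℝ) * n * P.N * P.L :=
        one_le_mul_of_one_le_of_one_le (one_le_mul_of_one_le_of_one_le (one_le_mul_of_one_le_of_one_le hκ1 hn1) hN1) hL1
      have hle : (P.LbRK κ lev P.jl : ℝ) ≤ 4 * ((κ : ℝ) * n * P.N * P.L) := by nlinarith
      have h4 : Real.log 4 ≤ 2 := by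
        have : Real.log 4 = 2 * Real.log 2 := by
          rw [show (4 : ℝ) = 2 ^ 2 by norm_num, Real.log_pow]; push_cast; ring
        linarith
      calc Real.log (P.LbRK κ lev P.jl : ℝ) ≤ Real.log (4 * ((κ : ℝ) * n * P.N * P.L)) := Real.log_le_log hpos hle
        _ = Real.log 4 + (Real.log κ + Real.log n + Real.log P.N + Real.log P.L) := by
            rw [Real.log_mul (by norm_num) (by positivity), Real.log_mul (by positivity) (by positivity),
              Real.log_mul (by positivity) (by positivity), Real.log_mul (by positivity) (by positivity)]
        _ ≤ 2 + n + n + P.WN + P.L / 2 ^ 21 := by linarith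
    have hB : Real.log (3 * (P.Nf lev ν : ℝ) + 2) ≤ (n : ℝ) + lev + 3 + P.X := by
      have h2p : (1 : ℝ) ≤ 2 ^ (ν + lev) := one_le_pow₀ (by norm_num)
      have h2ν : (2 : ℝ) ^ (ν + lev) ≤ 2 ^ (n + lev) := pow_le_pow_right₀ (by norm_num) (by omega)
      have hle : 3 * (P.Nf lev ν : ℝ) + 2 ≤ 2 ^ (n + lev + 3) * P.X := by
        have e : (2 : ℝ) ^ (n + lev + 3) = 8 * 2 ^ (n + lev) := by rw [pow_add]; ring
        rw [e]; nlinarith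
      calc Real.log (3 * (P.Nf lev ν : ℝ) + 2) ≤ Real.log (2 ^ (n + lev + 3) * P.X) := Real.log_le_log (by positivity) hle
        _ = ((n + lev + 3 : ℕ) : ℝ) * Real.log 2 + Real.log P.X := by rw [Real.log_mul (by positivity) (by positivity), Real.log_pow]
        _ ≤ (n : ℝ) + lev + 3 + P.X := by
            push_cast
            have h0 : (0 : ℝ) ≤ (n : ℝ) + lev + 3 := by positivity
            nlinarith
    rw [hQ, Real.log_mul hpos.ne' (by positivity)]
    have hn0 : (0 : ℝ) ≤ n := Nat.cast_nonneg n
    linarith [hA, hB, h16, hL512, hX, hWN, hlevL, hZ0, hU0]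
  calc (P.LbRK κ lev P.jl : ℝ) * Real.exp (-P.U0 c) * (3 * P.Nf lev ν + 2) = Q * Real.exp (-P.U0 c) := by rw [hQ]; ring
    _ ≤ Real.exp (P.U0 c) * Real.exp (-P.U0 c) := mul_le_mul_of_nonneg_right hQle (Real.exp_pos _).le
    _ = 1 := by rw [← Real.exp_add, add_neg_cancel, Real.exp_zero]

/-- **the Hasse-weight size of the k-steps against `Z`**: `log WC(H, Ŝ−lev, L₀, Tf lev ν, 3Nf lev ν+2) ≤ 2Z` (p1's ✓ `logWC_le` at
`e = Ŝ − lev` with `ρ = 3Nf+2 ≤ 2^lev·2^{n+6}·e^G·X`, then `Tf ≤ (33/2)(n+1)L`, `Ŝ·log 2 ≤ 10n + 29 + log N`, p1's ✓ `L₀_mul_le`).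
[cite: Nesterenko2003, §3.5 Lemma 3.10 (3.35); shape only] -/
theorem kj_logWC (hn2 : 2 ≤ n) {lev ν : ℕ} (hlev : lev ≤ P.Sd) (hν : ν ≤ n) :
    Real.log (WC P.H (P.Sd - lev) P.L₀ (P.Tf lev ν) (3 * P.Nf lev ν + 2)) ≤ 2 * P.Z := by
  obtain ⟨-, -, hNf1, hNf, -⟩ := P.kj_nodes lev ν
  have he : P.Sd - lev ≤ P.Sd := Nat.sub_le _ _
  have hX1 : (1 : ℝ) ≤ P.X := by have := P.X_floors.2.1; linarith
  have hρ0 : (0 : ℝ) ≤ 3 * P.Nf lev ν + 2 := by positivity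
  have hρ : (3 * P.Nf lev ν + 2 : ℝ) ≤ 2 ^ (P.Sd - (P.Sd - lev)) * (2 : ℝ) ^ (n + 6) * Real.exp (G n) * P.X := by
    rw [Nat.sub_sub_self hlev]
    have h2ν : (2 : ℝ) ^ (ν + lev) ≤ 2 ^ (n + lev) := pow_le_pow_right₀ (by norm_num) (by omega)
    have he1 : (1 : ℝ) ≤ Real.exp (G n) := Real.one_le_exp (G_pos n).le
    have h1 : (3 * P.Nf lev ν + 2 : ℝ) ≤ 2 ^ (n + lev + 3) * P.X := by
      have e : (2 : ℝ) ^ (n + lev + 3) = 8 * 2 ^ (n + lev) := by rw [pow_add]; ring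
      have h2p : (1 : ℝ) ≤ 2 ^ (n + lev) := one_le_pow₀ (by norm_num)
      rw [e]; nlinarith
    have h2 : (2 : ℝ) ^ (n + lev + 3) * P.X ≤ 2 ^ lev * (2 : ℝ) ^ (n + 6) * Real.exp (G n) * P.X := by
      have e : (2 : ℝ) ^ lev * (2 : ℝ) ^ (n + 6) = 2 ^ (n + lev + 3) * 2 ^ 3 := by rw [← pow_add, ← pow_add]; ring_nf
      rw [e]
      have hX0 : (0 : ℝ) ≤ P.X := by linarith
      have h8 : (2 : ℝ) ^ (n + lev + 3) * P.X * 1 ≤ 2 ^ (n + lev + 3) * P.X * (2 ^ 3 * Real.exp (G n)) :=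
        mul_le_mul_of_nonneg_left (by nlinarith) (by positivity)
      nlinarith
    exact h1.trans h2
  have h := P.logWC_le he (P.Tf lev ν) hρ0 hρ
  -- the three pieces
  have hT : (P.Tf lev ν : ℝ) ≤ P.Tf 0 0 := by exact_mod_cast P.Tf_le_Tf00 lev ν
  have hT00 := P.Tf00_le hn2
  have hSd := P.Sd_log_le.2
  have hL0m := P.L₀_mul_le hn2
  obtain ⟨hZ0, -, -, -, -, hXZ, -⟩ := P.kj_units
  obtain ⟨h16, -, -, -, hL512, hL10, hX, hWN, -⟩ := P.kj_units2
  obtain ⟨-, hLWNn, -⟩ := P.kj_LWN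
  obtain ⟨-, -, h512, -⟩ := P.Z_floors
  have hlogN := P.log_letters_le.2.2.1
  have hL0 : (0 : ℝ) ≤ P.L := Nat.cast_nonneg _
  have hn0 : (0 : ℝ) ≤ n := Nat.cast_nonneg n
  have hSd0 : (0 : ℝ) ≤ P.Sd * Real.log 2 := by have := Real.log_pos one_lt_two; positivity
  -- `Tf·(Ŝ log 2) ≤ (33/2)(n+1)L·(10n + 29 + log N) ≤ (33/2)(n+1)(10n+29)L + (33/2)(n+1) L WN`
  have h1 : (P.Tf lev ν : ℝ) * (P.Sd * Real.log 2) ≤ (33 / 2 * ((n : ℝ) + 1) * P.L) * (10 * n + 29 + P.WN) :=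
    mul_le_mul (hT.trans hT00) (by linarith) hSd0 (by positivity)
  have h2 : ((n : ℝ) + 1) * (10 * n + 29) * P.L ≤ 29 * ((n : ℝ) + 1) ^ 2 * P.L := by
    nlinarith [mul_nonneg (show (0 : ℝ) ≤ (n : ℝ) + 1 by positivity) hL0]
  have h3 : 29 * ((n : ℝ) + 1) ^ 2 * P.L ≤ 29 * P.Z / 512 := by
    rw [le_div_iff₀ (by norm_num)]; nlinarith
  linarith [h, h1, h2, h3, hLWNn, hXZ, hL0m, h16, hWN, hlogN]

/-- numerics: `2ⁿ·(2n + 16) + 16 ≤ 2^{8n}` for `n ≥ 1`. [folklore] -/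
theorem kj_num (hn : 1 ≤ n) : (2 : ℝ) ^ n * (2 * n + 16) + 16 ≤ 2 ^ (8 * n) := by
  have hn2n : (n : ℝ) ≤ 2 ^ n := by exact_mod_cast Nat.lt_two_pow_self.le
  have h1 : (1 : ℝ) ≤ 2 ^ n := one_le_pow₀ (by norm_num)
  have h2 : (2 : ℝ) ^ n * (2 * n + 16) + 16 ≤ 34 * (2 ^ n) ^ 2 := by nlinarith
  have h3 : (34 : ℝ) * (2 ^ n) ^ 2 ≤ 2 ^ (2 * n + 6) := by
    have e : (2 : ℝ) ^ (2 * n + 6) = ((2 : ℝ) ^ n) ^ 2 * 64 := by rw [pow_add, mul_comm 2 n, pow_mul]; norm_num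
    rw [e]; nlinarith [sq_nonneg ((2 : ℝ) ^ n)]
  have h4 : (2 : ℝ) ^ (2 * n + 6) ≤ 2 ^ (8 * n) := pow_le_pow_right₀ (by norm_num) (by omega)
  linarith

/-- **THE JETS LINE (J) of the k-steps** `(lev, ν) → (lev, ν+1)`, `lev ≤ Ŝ`, `ν < n`, for `P.LinesClosedK κ c` with `1 ≤ κ ≤ 2ⁿ`, sorted
weights, `2^{8n}·Z ≤ U₀(c)` and the two global atoms `cPRK κ ≤ cPz·Z`, `log WC(H, Ŝ−lev, L₀, Tf lev ν, 3Nf lev ν+2) ≤ cWz·Z` (`cPz, cWz ≤ 4`).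
[cite: Nesterenko2003, §4.2 (4.24)–(4.35), p. 87–90; shape only] -/
theorem kStepJ_holds (hn2 : 2 ≤ n) (hmono : Monotone P.A) (κ : ℕ) (hκ : 1 ≤ κ) (hκ2 : (κ : ℝ) ≤ 2 ^ n) {c : ℝ}
    (hU0 : (2 : ℝ) ^ (8 * n) * P.Z ≤ P.U0 c) {cPz cWz : ℝ} (hcPz : cPz ≤ 4) (hcWz : cWz ≤ 4) (hcP : P.cPRK κ ≤ cPz * P.Z)
    {lev ν : ℕ} (hlev : lev ≤ P.Sd) (hν : ν < n)
    (hWC : Real.log (WC P.H (P.Sd - lev) P.L₀ (P.Tf lev ν) (3 * P.Nf lev ν + 2)) ≤ cWz * P.Z) :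
    ∀ (x₁ : ℤ) (a : ℕ), |x₁| ≤ (P.Nf lev (ν + 1) : ℤ) → a < P.Tf lev (ν + 1) →
    P.γb lev * P.Nf lev (ν + 1) +
      Real.log (2 * ((2 * P.Nf lev ν + 1 : ℕ) : ℝ) ^ (P.T lev + 1) * P.T lev * (20 * Real.exp 1) ^ ((2 * P.Nf lev ν + 1) * P.T lev)) +
      P.T lev * Real.log (2 * P.CRK κ lev) + P.γb lev * (P.Nf lev ν + 1) + a * Real.log 2 + P.T lev + P.cUR + P.cPRK κ +
      Real.log (DΔC (P.YRK κ lev) (P.Tf lev (ν + 1))) + Real.log (WC P.H (P.Sd - lev) P.L₀ (P.Tf lev ν) (3 * P.Nf lev ν + 2)) +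
      (P.γb lev + P.wl lev) * P.Nf lev ν + P.cbRK κ c lev (P.Nf lev ν) + P.cDR lev a |(x₁ : ℝ)| + Real.log 3 ≤ 0 := by
  intro x₁ a hx ha
  obtain ⟨hZ0, -⟩ := P.kj_units
  obtain ⟨h16, hnZ, h2Z, -⟩ := P.kj_units2
  obtain ⟨t1, -, -⟩ := P.kj_γb_Nf lev (ν + 1) (by omega)
  have t2 := P.kj_schwarz hlev hν.le
  have t3 := P.kj_TlogCRK κ hκ hκ2 hmono hlev
  obtain ⟨t4, t10, t4'⟩ := P.kj_γb_Nf lev ν hν.le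
  have t5 := P.kj_aT hn2 lev ν ha
  have t6 := P.kj_cUR
  have t8 := P.kj_logDΔC hn2 κ hκ hκ2 lev lev (ν + 1)
  obtain ⟨-, -, -, hNf, -⟩ := P.kj_nodes lev ν
  have hNf' : (P.Nf lev ν : ℝ) ≤ 2 ^ (n + lev) * P.X :=
    hNf.trans (mul_le_mul_of_nonneg_right (pow_le_pow_right₀ (by norm_num) (by omega)) (Nat.cast_nonneg _))
  have t11 := P.kj_cbRK κ hκ hκ2 c hlev hNf'
  have t12 := P.kj_cDR hn2 hν ha hx
  have hl3 : Real.log 3 ≤ 2 := by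
    have : Real.log 3 ≤ 3 - 1 := Real.log_le_sub_one_of_pos (by norm_num)
    linarith
  have hnum := kj_num P.hn
  have hnumZ : ((2 : ℝ) ^ n * (2 * n + 16) + 16) * P.Z ≤ 2 ^ (8 * n) * P.Z := mul_le_mul_of_nonneg_right hnum hZ0.le
  have e4 : P.γb lev * ((P.Nf lev ν : ℝ) + 1) = P.γb lev * P.Nf lev ν + P.γb lev := by ring
  have hcP' : P.cPRK κ ≤ 4 * P.Z := hcP.trans (by nlinarith)
  have hWC' : Real.log (WC P.H (P.Sd - lev) P.L₀ (P.Tf lev ν) (3 * P.Nf lev ν + 2)) ≤ 4 * P.Z := hWC.trans (by nlinarith)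
  rw [e4]
  have hn0 : (0 : ℝ) ≤ n := Nat.cast_nonneg n
  have hM0 : 0 ≤ (n : ℝ) * (2 ^ n * P.Z) := by positivity
  linarith [t1, t2, t3, t4, t4', t5, t6, t8, t10, t11, t12, hl3, hnumZ, hU0, hcP', hWC', h16, hnZ, h2Z, hZ0, hM0]

/-- **THE CLOSING LINE (C) of the k-steps** (same hypotheses as `kStepJ_holds`). [cite: Nesterenko2003, §4.2 (4.35), p. 90; shape only] -/
theorem kStepC_holds (hn2 : 2 ≤ n) (κ : ℕ) (hκ : 1 ≤ κ) (hκ2 : (κ : ℝ) ≤ 2 ^ n) {c : ℝ}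
    (hU0 : (2 : ℝ) ^ (8 * n) * P.Z ≤ P.U0 c) {cPz cWz : ℝ} (hcPz : cPz ≤ 4) (hcWz : cWz ≤ 4) (hcP : P.cPRK κ ≤ cPz * P.Z)
    {lev ν : ℕ} (hlev : lev ≤ P.Sd) (hν : ν < n)
    (hWC : Real.log (WC P.H (P.Sd - lev) P.L₀ (P.Tf lev ν) (3 * P.Nf lev ν + 2)) ≤ cWz * P.Z) :
    ∀ (x₁ : ℤ) (a : ℕ), |x₁| ≤ (P.Nf lev (ν + 1) : ℤ) → a < P.Tf lev (ν + 1) →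
    P.cUR + P.cPRK κ + Real.log (DΔC (P.YRK κ lev) (P.Tf lev (ν + 1))) + Real.log (WC P.H (P.Sd - lev) P.L₀ (P.Tf lev ν) (3 * P.Nf lev ν + 2)) +
      (P.γb lev + P.wl lev) * P.Nf lev (ν + 1) + P.cbRK κ c lev (P.Nf lev (ν + 1)) + P.cDR lev a |(x₁ : ℝ)| + Real.log 3 < 0 := by
  intro x₁ a hx ha
  obtain ⟨hZ0, -⟩ := P.kj_units
  obtain ⟨h16, hnZ, h2Z, -⟩ := P.kj_units2
  obtain ⟨-, t10, -⟩ := P.kj_γb_Nf lev (ν + 1) (by omega)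
  have t6 := P.kj_cUR
  have t8 := P.kj_logDΔC hn2 κ hκ hκ2 lev lev (ν + 1)
  obtain ⟨-, -, -, hNf, -⟩ := P.kj_nodes lev (ν + 1)
  have hNf' : (P.Nf lev (ν + 1) : ℝ) ≤ 2 ^ (n + lev) * P.X :=
    hNf.trans (mul_le_mul_of_nonneg_right (pow_le_pow_right₀ (by norm_num) (by omega)) (Nat.cast_nonneg _))
  have t11 := P.kj_cbRK κ hκ hκ2 c hlev hNf'
  have t12 := P.kj_cDR hn2 hν ha hx
  have hl3 : Real.log 3 ≤ 2 := by
    have : Real.log 3 ≤ 3 - 1 := Real.log_le_sub_one_of_pos (by norm_num)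
    linarith
  have hnum := kj_num P.hn
  have hnumZ : ((2 : ℝ) ^ n * (2 * n + 16) + 16) * P.Z ≤ 2 ^ (8 * n) * P.Z := mul_le_mul_of_nonneg_right hnum hZ0.le
  have hcP' : P.cPRK κ ≤ 4 * P.Z := hcP.trans (by nlinarith)
  have hWC' : Real.log (WC P.H (P.Sd - lev) P.L₀ (P.Tf lev ν) (3 * P.Nf lev ν + 2)) ≤ 4 * P.Z := hWC.trans (by nlinarith)
  have hn0 : (0 : ℝ) ≤ n := Nat.cast_nonneg n
  have hM0 : 0 ≤ (n : ℝ) * (2 ^ n * P.Z) := by positivity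
  linarith [t6, t8, t10, t11, t12, hl3, hnumZ, hU0, hcP', hWC', h16, hnZ, h2Z, hZ0, hM0]

/-- **THE k-STEP LINES `KStepLinesK κ c lev ν` FROM THE FAR LINE (F)** (the (F) conjunct is p1 g11's; the three side conditions are
p1's ✓ `side_kstep`; smallness, (J), (C) above).  Use at `(0, ν)`, `ν < n`, and at `(lev+1, ν)`, `lev < Ŝ`, `1 ≤ ν < n`.
[cite: Nesterenko2003, §4.2; shape only] -/
theorem kStepLinesK_of_far (hn2 : 2 ≤ n) (hmono : Monotone P.A) (κ : ℕ) (hκ : 1 ≤ κ) (hκ2 : (κ : ℝ) ≤ 2 ^ n) {c : ℝ}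
    (hU0 : (2 : ℝ) ^ (8 * n) * P.Z ≤ P.U0 c) {cPz : ℝ} (hcPz : cPz ≤ 4) (hcP : P.cPRK κ ≤ cPz * P.Z)
    {lev ν : ℕ} (hlev : lev ≤ P.Sd) (hν : ν < n)
    (hF : ∀ (x₁ : ℤ) (a : ℕ), |x₁| ≤ (P.Nf lev (ν + 1) : ℤ) → a < P.Tf lev (ν + 1) →
      P.γb lev * P.Nf lev (ν + 1) + P.cUR + P.cPRK κ + Real.log (DΔC (P.YRK κ lev) (P.Tf lev (ν + 1))) +
        Real.log (WC P.H (P.Sd - lev) P.L₀ (P.Tf lev (ν + 1)) ((3 * Real.exp (G n) + 1) * (2 * P.Nf lev ν + 1) + P.Nf lev ν)) +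
        (P.wl lev + (P.LbRK κ lev P.jl : ℝ) * P.δR c) * ((3 * Real.exp (G n) + 1) * (2 * P.Nf lev ν + 1) + P.Nf lev ν) -
        (((2 * P.Nf lev ν + 1) * P.T lev : ℕ) : ℝ) * G n + P.cDR lev a |(x₁ : ℝ)| + Real.log 3 ≤ 0) :
    P.KStepLinesK κ c lev ν := by
  obtain ⟨h1, h2, h3⟩ := P.side_kstep lev ν hν
  have hU0' : P.Z ≤ P.U0 c := by
    have h8 : (1 : ℝ) ≤ 2 ^ (8 * n) := one_le_pow₀ (by norm_num)
    have hZ0 := P.kj_units.1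
    nlinarith
  have hWC := P.kj_logWC hn2 hlev hν.le
  have h24 : (2 : ℝ) ≤ 4 := by norm_num
  exact ⟨h1, h2, h3, P.kj_small κ hκ hκ2 hlev hν.le hU0', P.kStepJ_holds hn2 hmono κ hκ hκ2 hU0 hcPz h24 hcP hlev hν hWC, hF,
    P.kStepC_holds hn2 κ hκ hκ2 hU0 hcPz h24 hcP hlev hν hWC⟩

/-- numerics for the line's adjugate parameter `κ = 2^{n−1}`: `1 ≤ 2^{n−1}` and `(2^{n−1} : ℝ) ≤ 2ⁿ`. [folklore] -/
theorem kj_kappa : 1 ≤ 2 ^ (n - 1) ∧ (((2 ^ (n - 1) : ℕ) : ℝ)) ≤ (2 : ℝ) ^ n := by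
  refine ⟨Nat.one_le_two_pow, ?_⟩
  push_cast
  exact pow_le_pow_right₀ (by norm_num) (Nat.sub_le n 1)

/-- **BOTH k-STEP FAMILIES of `P.LinesClosedK (2^{n−1}) c`** — level `0`: `KStepLinesK (2^{n−1}) c 0 ν` for `ν < n`; deep levels:
`KStepLinesK (2^{n−1}) c (lev+1) ν` for `lev < Ŝ`, `1 ≤ ν < n` — from sorted weights, `n ≥ 2`, the floor `2^68 ≤ c` (`U0_ge 8`), the START
print `cPRK (2^{n−1}) ≤ cPz·Z` (`cPz ≤ 4`; p1's `cPRK_two_pow_le`: 51/25) and p1's far lines (F) `hF` at every `(lev, ν)`, `lev ≤ Ŝ`, `ν < n`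
(`kstepF_holds`).  This is the K0/K input of p5's assembly `linesClosedK_holds`. [cite: Nesterenko2003, §4.2; shape only] -/
theorem kFamilies_of_far (hn2 : 2 ≤ n) (hmono : Monotone P.A) {c : ℝ} (hc : (2 : ℝ) ^ 68 ≤ c) {cPz : ℝ} (hcPz : cPz ≤ 4)
    (hcP : P.cPRK (2 ^ (n - 1)) ≤ cPz * P.Z)
    (hF : ∀ lev ν, lev ≤ P.Sd → ν < n → ∀ (x₁ : ℤ) (a : ℕ), |x₁| ≤ (P.Nf lev (ν + 1) : ℤ) → a < P.Tf lev (ν + 1) →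
      P.γb lev * P.Nf lev (ν + 1) + P.cUR + P.cPRK (2 ^ (n - 1)) + Real.log (DΔC (P.YRK (2 ^ (n - 1)) lev) (P.Tf lev (ν + 1))) +
        Real.log (WC P.H (P.Sd - lev) P.L₀ (P.Tf lev (ν + 1)) ((3 * Real.exp (G n) + 1) * (2 * P.Nf lev ν + 1) + P.Nf lev ν)) +
        (P.wl lev + (P.LbRK (2 ^ (n - 1)) lev P.jl : ℝ) * P.δR c) * ((3 * Real.exp (G n) + 1) * (2 * P.Nf lev ν + 1) + P.Nf lev ν) -
        (((2 * P.Nf lev ν + 1) * P.T lev : ℕ) : ℝ) * G n + P.cDR lev a |(x₁ : ℝ)| + Real.log 3 ≤ 0) :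
    (∀ ν, ν < n → P.KStepLinesK (2 ^ (n - 1)) c 0 ν) ∧
    (∀ lev < P.Sd, ∀ ν, 1 ≤ ν → ν < n → P.KStepLinesK (2 ^ (n - 1)) c (lev + 1) ν) := by
  obtain ⟨hκ, hκ2⟩ := kj_kappa (n := n)
  have hU0 : (2 : ℝ) ^ (8 * n) * P.Z ≤ P.U0 c := P.U0_ge 8 (by rw [show (8 : ℕ) + 60 = 68 by norm_num]; exact hc)
  refine ⟨fun ν hν => ?_, fun lev hlev ν _ hν => ?_⟩
  · exact P.kStepLinesK_of_far hn2 hmono _ hκ hκ2 hU0 hcPz hcP (Nat.zero_le _) hν (hF 0 ν (Nat.zero_le _) hν)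
  · exact P.kStepLinesK_of_far hn2 hmono _ hκ hκ2 hU0 hcPz hcP (by omega) hν (hF (lev + 1) ν (by omega) hν)

end ArchG3Rec

end Summit.ABC.StewartYu

end
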